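import Literature.MathematicalPhysics.KineticTheory.InfiniteChainGibbsExistenceShift

/-!
# `stub_gibbsFamily` — the thermal family exists (crux `EmbeddedDrudeMourre.GreenKuboContinuation`,
# stmt-AtomisticToContinuum-12597, line `temperature-blind-vitali-hurwitz`, skeleton rev 5–6, Stub 1a)

`--supports` file. The registered stub asks, for `pinnedChain ω₂ lam β γ` (all four `> 0`), for a family
`T ↦ μ T` of DLR Gibbs states which are shift invariant and satisfy Buttà–Marchioro's superstability
estimate (2.3) at every `T > 0`. This is now a one-line consequence of the Literature theorem
`OscillatorChain.exists_gibbsFamily_pinnedChain` (`InfiniteChainGibbsExistenceShift.lean`, p94153,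
landed upstream by prover-pitem-stmt-AtomisticToContinuum-0743-0: the two-sided stationary Markov chain of the
strictly positive Hilbert–Schmidt transfer operator, Jentzsch eigenfunction, window densities ⇒ DLR +
shift invariance + (2.3)), whose hypotheses `0 < ω₂`, `0 ≤ lam`, `0 ≤ β` are weaker than the stub's.
-/

noncomputable section

namespace Summit.AtomisticToContinuum.FouriersLaw.Theorems.GreenKuboContinuation.TemperatureBlindVitaliHurwitz

/-- **Stub 1a `stub_gibbsFamily` (registered signature, verbatim): the pinned anharmonic chain has, at every
temperature `T > 0`, a DLR Gibbs state which is shift invariant and obeys BM's superstability estimate (2.3).**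
One-liner from `OscillatorChain.exists_gibbsFamily_pinnedChain`; `0 < γ` is decoration (the bath coupling does
not enter the closed chain) and `0 < lam`, `0 < β` are used only through `≤`. [cite: Georgii2011, Thm 10.25 and §11.1] -/
theorem stub_gibbsFamily :
    ∀ ω₂ lam β γ : ℝ, 0 < ω₂ → 0 < lam → 0 < β → 0 < γ →
      ∃ μ : ℝ → MeasureTheory.Measure
            Literature.MathematicalPhysics.KineticTheory.HeatConduction.ChainConfig,
        ∀ T : ℝ, 0 < T →
          (Literature.MathematicalPhysics.KineticTheory.HeatConduction.pinnedChain
                ω₂ lam β γ).IsChainGibbsMeasure T (μ T) ∧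
          Literature.MathematicalPhysics.KineticTheory.HeatConduction.IsShiftInvariant (μ T) ∧
          (Literature.MathematicalPhysics.KineticTheory.HeatConduction.pinnedChain
                ω₂ lam β γ).HasSuperstabilityEstimate (μ T) :=
  fun _ω₂ _lam _β γ hω hl hβ _hγ =>
    Literature.MathematicalPhysics.KineticTheory.HeatConduction.OscillatorChain.exists_gibbsFamily_pinnedChain
      γ hω hl.le hβ.le

end Summit.AtomisticToContinuum.FouriersLaw.Theorems.GreenKuboContinuation.TemperatureBlindVitaliHurwitz

end
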